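import Summits.AtomisticToContinuum.HydrodynamicLimit.Theorems.InformationPercolationEngineChaosClosesEulerDock
import Summits.AtomisticToContinuum.HydrodynamicLimit.Theorems.InformationPercolationEngineChaosClosesEulerEntropyBalance
import Summits.AtomisticToContinuum.HydrodynamicLimit.Theorems.InformationPercolationEngineChaosClosesEulerDissipationRigidity
import Summits.AtomisticToContinuum.HydrodynamicLimit.Theorems.InformationPercolationEngineChaosClosesEulerLocalEquilibriumFromDissipation
import Literature.Analysis.FluidPDE.BoltzmannEquation
import HarnessLib

/-!
# Line `EmpiricalHTheorem` — crux `InformationPercolationEngine.ChaosClosesEuler` (stmt-AtomisticToContinuum-15141)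

**v2 (lead `prover-line-stmt-AtomisticToContinuum-15141-c4-0`, 2026-08-17T16:0xZ): ADOPTED by the lead after `Sketch` completed (v15) and its
rigidity sub-line died by R3 (`NOTES.md` §G2, §G6); wave 11 LANDED all three provable stubs — `stub_windowedEntropyBalance`
(p166416 + helpers A–G), `stub_dissipationRigidity` (p164687 + A–G), `stub_localEquilibriumFromDissipation` (p169406 + A–I) — so
the line is COMPLETE MODULO INPUTS: the remaining sorries are `stub_boardInputs` (PEC ∧ 13352 ∧ 13354 ∧ 9235 ∧ 13082, items)
and `stub_entropicChaos` (PEnC, the one new kinetic input).  The kinetic dock `PEnC → PEC → 13352 → 13354 → 9235 → 13082 →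
ChaosClosesEuler` is landed as `Theorems/InformationPercolationEngineChaosClosesEulerKineticDock.lean` (p169796; `NOTES.md` §H,
`SPLIT-AMENDMENT.md` v2).**  Original header (strategist s2):
AN ALTERNATIVE LINE registered by crux-strategist s2 (2026-08-17), alongside the lead's line `Sketch` (v13).  It shares
the LANDED local-equilibrium dock (`Theorems.ChaosClosesEulerDock.stub_dock`, p157936:
`PLE → PEC → 13352 → 13354 → 9235 → 13082 → ChaosClosesEuler`) and differs in HOW pointwise local equilibrium (PLE)
is obtained.

THE LEVER: BOLTZMANN'S H-THEOREM MADE EMPIRICAL.  The `δ`-coarse-grained entropy of the `r`-cone velocity law is a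
bounded functional of the configuration, so — exactly like windowed collision invariance (landed p102261) — the
`(ε/(N+1))`-normalised windowed collision functional of its jump mark, the ENTROPIC MARK
`Λ̃_x(vᵢ⁻) − Λ̃_x(vᵢ⁺)` (`Λ̃ = φ_δ ∗ ℓ_K(g)`, `g` the `δ`-mollified cone law, `ℓ_K` the log floored at depth `K`), is `O(ε)` plus a
second-order remainder paid by quartic collision tightness: `WindowedEntropyBalance` (WEB, deterministic, provable).
SAME-TIME molecular chaos for that ONE law-dependent mark (`PointwiseEntropicChaos`, the line's kinetic INPUT, in the
format of `PointwiseEnskogCollisions`) converts the windowed functional into `σ³ Y h · D(G̃_{s,x})`, the entropy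
production of the smoothed cone law `G̃ = exp Λ̃` restricted to a collision-invariant pair-energy set
`{|v|²+|u|² ≤ L}` — which is NONNEGATIVE termwise (Boltzmann's inequality,
`Literature.Analysis.FluidPDE.entropyProduction_nonneg`).  Hence `∫∫ h Y D(G̃_{s,x}) ds dx → 0` in probability with
the absolute value OUTSIDE for free: positivity defeats the non-convexity of collisional balance that forces the lead's
line to use TWO pointwise chaos inputs (same-time PEC AND two-time PCC) plus the energy-distance argument and
`BalanceRigidity` (13355).  `DissipationRigidity` (provable: Fatou as the floor depth `K → ∞`, in-tree
classification of continuous collision invariants `IsCollisionInvariant.exists_eq_quadratic_holds`, Gaussian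
deconvolution by characteristic functions) then says: small `D(G̃[m])` + mass/temperature cut-offs + UI energy ⇒ the
`ψ`-moments of `m` are those of the Maxwellian of its own fields — i.e. PLE, window by window.  The within-window
kinetic-scale oscillation (`NOTES.md` §B2/§F1/§F2 of the lead) is excluded because chaotic collisions w.r.t. a
non-Maxwellian law RAISE the coarse entropy at rate `D/ε` while the coarse entropy is bounded.

STUBS (5): `stub_boardInputs` [EXTERNAL: PEC (for the dock) ∧ 13352 ∧ 13354 ∧ 9235 ∧ 13082, by name],
`stub_entropicChaos` [NEW INPUT, Boltzmann-hypothesis class: `PointwiseEntropicChaos`], `stub_windowedEntropyBalance`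
[own, L, provable now: `WindowedEntropyBalance`], `stub_dissipationRigidity` [own, L, provable now:
`DissipationRigidity`], `stub_localEquilibriumFromDissipation` [own, XL−, the assembly:
`WEB → PEnC → DissipationRigidity → 9235 → 13354 → PLE`].  Composition `ChaosClosesEuler_of` = `stub_dock` (landed).

DISPROOF USED: `Cruxes/ChaosClosesEuler/Disproof.lean` v2 — §3 tie / balance laws load-bearing (honoured: the dock is
the landed one), no `_false_without_` obstruction bears on the kinetic half; `Theorems/ChaosClosesEuler/Negative/Structure.lean`
kills no stub.  Card: `Lines/empirical-h-theorem.md`.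
-/

noncomputable section

namespace Summit.AtomisticToContinuum.HydrodynamicLimit.Cruxes.ChaosClosesEuler.EmpiricalHTheorem

open scoped BigOperators Topology Classical MeasureTheory ENNReal InnerProductSpace
open Filter Set MeasureTheory
open Literature.MathematicalPhysics.KineticTheory
open Literature.Analysis.FluidPDE
open Summit.AtomisticToContinuum.HydrodynamicLimit.Theses
open Summit.AtomisticToContinuum.HydrodynamicLimit.Theses.InformationPercolationEngine

/-! ## §1 Waypoints -/

/-- **Pointwise local equilibrium at scale `r`, in band, pre-shock** — VERBATIM the hypothesis `hPLE` of the landed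
dock `Theorems.ChaosClosesEulerDock.stub_dock` (= skeleton v11 §1b `PointwiseLocalEquilibrium` = the strategist-s1
child `KineticLocalEquilibrium`). -/
def PointwiseLocalEquilibrium : Prop :=
  ∃ η₀ : ℝ, 0 < η₀ ∧ ∀ (a₀ θ₀ : T3 → ℝ) (u₀ : T3 → V3), Continuous a₀ → Continuous θ₀ → Continuous u₀ →
    (∀ x, 0 < a₀ x) → (∀ x, 0 < θ₀ x) → ∃ σ₀ : ℝ, 0 < σ₀ ∧ ∀ σ : ℝ, 0 < σ → σ < σ₀ →
    ∀ (T : ℝ) (ρ θ : ℝ → T3 → ℝ) (u : ℝ → T3 → V3), IsHardSphereEulerSolution σ T ρ u θ →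
    ∀ Φ : (N : ℕ) → HardSphereFlow (Torus.geometry (Fin 3)) (hsDiameter σ N) (N + 1),
    TendstoHydroFieldsAt (fun N => localGibbsLaw σ a₀ u₀ θ₀ N (Φ N)) Φ ρ u θ 0 →
    ∀ t ∈ Set.Ico 0 T, ∀ ψ : V3 → ℝ, Continuous ψ → (∃ C : ℝ, ∀ v, |ψ v| ≤ C) →
    ∀ h : ℝ × V3 × ℝ → ℝ, Continuous h → (∃ C : ℝ, ∀ p, |h p| ≤ C) →
    (∃ ρ₁ θ₁ Θ U : ℝ, 0 < ρ₁ ∧ 0 < θ₁ ∧ ∀ p : ℝ × V3 × ℝ,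
      (p.1 ≤ ρ₁ ∨ η₀ ≤ σ ^ 3 * p.1 ∨ p.2.2 ≤ θ₁ ∨ Θ ≤ p.2.2 ∨ U ≤ ‖p.2.1‖) → h p = 0) →
    ∀ η δ : ℝ, 0 < η → 0 < δ → ∃ r₀ : ℝ, 0 < r₀ ∧ ∀ r : ℝ, 0 < r → r < r₀ → ∃ N₀ : ℕ, ∀ N : ℕ, N₀ ≤ N →
    let bx : T3 → T3 → ℝ := fun y x => 3 / (Real.pi * r ^ 3) * max (1 - Torus.euclidDist y x / r) 0
    let ρm : Config (N + 1) (Fin 3) T3 → T3 → ℝ := fun w x₀ => ∫ q, bx q.1 x₀ ∂(empiricalMeasure w)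
    let mm : Config (N + 1) (Fin 3) T3 → T3 → V3 := fun w x₀ => ∫ q, bx q.1 x₀ • q.2 ∂(empiricalMeasure w)
    let em : Config (N + 1) (Fin 3) T3 → T3 → ℝ := fun w x₀ =>
      ∫ q, bx q.1 x₀ * (‖q.2‖ ^ 2 / 2) ∂(empiricalMeasure w)
    let um : Config (N + 1) (Fin 3) T3 → T3 → V3 := fun w x₀ => (ρm w x₀)⁻¹ • mm w x₀
    let θm : Config (N + 1) (Fin 3) T3 → T3 → ℝ := fun w x₀ =>
      2 / 3 * (em w x₀ / ρm w x₀ - ‖mm w x₀‖ ^ 2 / (2 * ρm w x₀ ^ 2))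
    let Mψ : Config (N + 1) (Fin 3) T3 → T3 → ℝ := fun w x₀ => ∫ q, bx q.1 x₀ * ψ q.2 ∂(empiricalMeasure w)
    localGibbsLaw σ a₀ u₀ θ₀ N (Φ N)
      {z | η < ∫ s in Set.Icc 0 t, ∫ x,
        |h (ρm ((Φ N).flow s z) x, um ((Φ N).flow s z) x, θm ((Φ N).flow s z) x)| *
          |Mψ ((Φ N).flow s z) x - ρm ((Φ N).flow s z) x *
            ∫ v, ψ v * localMaxwellian 1 (θm ((Φ N).flow s z) x) (um ((Φ N).flow s z) x) v|} ≤ ENNReal.ofReal δ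

/-- **Pointwise Enskog collision statistics** — VERBATIM the hypothesis `hPEC` of the landed dock (= v11 §1b
`PointwiseEnskogCollisions` = the s1 child of the same name).  Consumed by the dock only (collisional pressure
value); an INPUT of this line. -/
def PointwiseEnskogCollisions : Prop :=
  ∃ η₀ : ℝ, 0 < η₀ ∧ ∀ (a₀ θ₀ : T3 → ℝ) (u₀ : T3 → V3), Continuous a₀ → Continuous θ₀ → Continuous u₀ →
    (∀ x, 0 < a₀ x) → (∀ x, 0 < θ₀ x) → ∃ σ₀ : ℝ, 0 < σ₀ ∧ ∀ σ : ℝ, 0 < σ → σ < σ₀ →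
    ∀ Φ : (N : ℕ) → HardSphereFlow (Torus.geometry (Fin 3)) (hsDiameter σ N) (N + 1),
    ∀ τ : ℝ, 0 < τ → ∀ G : V3 × V3 × V3 → ℝ, Continuous G → (∃ C : ℝ, ∀ p, |G p| ≤ C) →
    ∀ h : ℝ × V3 × ℝ → ℝ, Continuous h → (∃ C : ℝ, ∀ p, |h p| ≤ C) →
    (∀ p : ℝ × V3 × ℝ, η₀ ≤ σ ^ 3 * p.1 → h p = 0) →
    ∀ η δ : ℝ, 0 < η → 0 < δ → ∃ r₀ : ℝ, 0 < r₀ ∧ ∀ r : ℝ, 0 < r → r < r₀ → ∃ N₀ : ℕ, ∀ N : ℕ, N₀ ≤ N →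
    let ε := hsDiameter σ N
    let Gm : Geometry (Fin 3) T3 := Torus.geometry (Fin 3)
    let γ : Config (N + 1) (Fin 3) T3 → ℝ → Config (N + 1) (Fin 3) T3 := fun z s => (Φ N).flow s z
    let bx : T3 → T3 → ℝ := fun y x => 3 / (Real.pi * r ^ 3) * max (1 - Torus.euclidDist y x / r) 0
    let bt : ℝ → ℝ := fun a => r⁻¹ * max (1 - |a| / r) 0
    let ρm : Config (N + 1) (Fin 3) T3 → T3 → ℝ := fun w x₀ => ∫ q, bx q.1 x₀ ∂(empiricalMeasure w)
    let mm : Config (N + 1) (Fin 3) T3 → T3 → V3 := fun w x₀ => ∫ q, bx q.1 x₀ • q.2 ∂(empiricalMeasure w)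
    let em : Config (N + 1) (Fin 3) T3 → T3 → ℝ := fun w x₀ =>
      ∫ q, bx q.1 x₀ * (‖q.2‖ ^ 2 / 2) ∂(empiricalMeasure w)
    let um : Config (N + 1) (Fin 3) T3 → T3 → V3 := fun w x₀ => (ρm w x₀)⁻¹ • mm w x₀
    let θm : Config (N + 1) (Fin 3) T3 → T3 → ℝ := fun w x₀ =>
      2 / 3 * (em w x₀ / ρm w x₀ - ‖mm w x₀‖ ^ 2 / (2 * ρm w x₀ ^ 2))
    let Hw : Config (N + 1) (Fin 3) T3 → T3 → ℝ := fun w x => h (ρm w x, um w x, θm w x)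
    let Θ : V3 → V3 → ℝ := fun v w =>
      ∫ ω : Metric.sphere (0 : V3) 1, G ((ω : V3), v, w) * hardSphereKernel (w, v) ω ∂sphereMeasure
    let BG : Config (N + 1) (Fin 3) T3 → T3 → ℝ := fun w x₀ =>
      ∫ p, bx p.1.1 x₀ * bx p.2.1 x₀ * Θ p.1.2 p.2.2 ∂((empiricalMeasure w).prod (empiricalMeasure w))
    let pv : Config (N + 1) (Fin 3) T3 → ℝ → Fin (N + 1) → Fin (N + 1) → V3 × V3 := fun z s i j =>
      reflectVel (Gm.sepVec (γ z s i).1 (γ z s j).1) ((γ z s i).2, (γ z s j).2)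
    let Y : ℝ → ℝ := fun a => 3 / (2 * Real.pi) * deriv hsExcessFreeEnergy a
    let Kr : Config (N + 1) (Fin 3) T3 → ℝ → T3 → ℝ := fun z t₀ x₀ =>
      ε / (N + 1 : ℝ) * ∑ᶠ (s : ℝ) (_ : s ∈ collisionTimes Gm ε (γ z) ∩ Set.Icc 0 τ),
        ∑ i : Fin (N + 1), ∑ j : Fin (N + 1),
          (if i ≠ j ∧ ‖Gm.sepVec (γ z s i).1 (γ z s j).1‖ = ε then
            bt (s - t₀) * bx (γ z s i).1 x₀ * Hw (γ z s) (γ z s i).1 *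
              G (ε⁻¹ • Gm.sepVec (γ z s i).1 (γ z s j).1, (pv z s i j).1, (pv z s i j).2) else 0)
    let R : Config (N + 1) (Fin 3) T3 → ℝ → T3 → ℝ := fun z t₀ x₀ =>
      σ ^ 3 * ∫ s in Set.Icc 0 τ, bt (s - t₀) *
        ∫ x, bx x x₀ * (Hw (γ z s) x * Y (σ ^ 3 * ρm (γ z s) x) * BG (γ z s) x)
    localGibbsLaw σ a₀ u₀ θ₀ N (Φ N)
      {z | η < ∫ t₀ in Set.Icc 0 τ, ∫ x₀, |Kr z t₀ x₀ - R z t₀ x₀|} ≤ ENNReal.ofReal δ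

/-- **Windowed entropy balance (WEB; own, deterministic, provable now — the entropic twin of
`WindowedCollisionInvariance`).**  Fix `σ, τ, r`, a velocity coarse-graining `δ > 0`, a log-floor depth `K` and a
bounded Lipschitz density weight `h`.  Along every good orbit and for every window `(t₀, x₀)`, the tent × cone
windowed, `(ε/(N+1))`-normalised collision functional of the ENTROPIC MARK of particle `i` of each ordered contact
pair, `∫ₓ b_r(x,x₀) h(ρ_r(x)) b_r(xᵢ,x) [Λ̃_x(vᵢ⁻) − Λ̃_x(vᵢ⁺)] dx`, is bounded by
`ε · C₁ · (1 + E/(N+1))³ + C₂ · Q⁴_N/(N+1)` with `C₁, C₂` depending on `σ, τ, r, δ, K, ‖h‖, Lip h` only and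
`Q⁴_N = (ε/(N+1)) Σ_{collisions ≤ τ} (1 + |vᵢ|⁴ + |vⱼ|⁴)` the quartic collision functional (tight by 13354).  Here
`g_x(v) = ∫ b_r(q.x, x) φ_δ(v − q.v) dμ_N(q)` is the `δ`-mollified `x`-cone velocity law (a smooth density of mass
`ρ_r(x)`), `ℓ_K(v, y)` the logarithm floored `C¹`-smoothly at the level `y₀(v) = e^{−K}(1+|v|²)⁻²`
(`= log y` for `y ≥ y₀(v)`, `= log y₀(v) + (y − y₀(v))/y₀(v)` below) and `Λ̃_x = φ_δ ∗ ℓ_K(·, g_x(·))` the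
(doubly mollified) floored log-density.  Proof: the functional `𝒮(z) = ∫ₓ b_r(x,x₀) h(ρ_r(x)) S_K(g_x) dx`,
`S_K(g) = −∫ 𝔰_K(v, g(v)) dv` with `∂_y 𝔰_K = 1 + ℓ_K` (`= y log y` above the floor, its convex `C²` continuation
below), satisfies `|𝒮| ≤ C` (mass only) and is Lipschitz in time between collisions with constant `C(1 + E/(N+1))²`
(positions move, `∇b_r` bounded, `|ℓ_K| ≤ K + 1 + 2 log(1+|v|²) + |log sup g|`); at a collision it jumps by EXACTLY
`(N+1)⁻¹ ×` the entropic marks of the two partners (first-order Taylor at the pre-collisional configuration; using the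
post-collisional one in `Λ̃` costs `≤ C e^K (1+|v|⁴)/(N+1)²`) plus the second-order remainder
`≤ ½ sup ∂²_y𝔰_K · ∫(Δg)² ≤ C e^K (1 + |vᵢ⁺|⁴ + |vᵢ⁻|⁴)/(N+1)²` (`∂²_y 𝔰_K ≤ 1/y₀(v)`); Abel summation against the
tent `bt` as in `stub_collisionInvariance` (landed p98069); multiply by `ε`. [folklore; Boltzmann's H-functional,
coarse-grained] -/
def WindowedEntropyBalance : Prop :=
  ∀ (σ : ℝ), 0 < σ → σ < 2⁻¹ → ∀ (τ r δ K : ℝ), 0 < τ → 0 < r → 0 < δ →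
    ∀ (h : ℝ → ℝ) (Ch Lh : ℝ), 0 ≤ Ch → 0 ≤ Lh → (∀ a, |h a| ≤ Ch) → (∀ a b, |h a - h b| ≤ Lh * |a - b|) →
    ∃ C₁ C₂ : ℝ, ∀ (N : ℕ) (Φ : HardSphereFlow (Torus.geometry (Fin 3)) (hsDiameter σ N) (N + 1)),
    ∀ z ∈ Φ.good, ∀ (t₀ : ℝ) (x₀ : T3),
    let ε := hsDiameter σ N
    let Gm : Geometry (Fin 3) T3 := Torus.geometry (Fin 3)
    let γ : ℝ → Config (N + 1) (Fin 3) T3 := fun s => Φ.flow s z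
    let bx : T3 → T3 → ℝ := fun y x => 3 / (Real.pi * r ^ 3) * max (1 - Torus.euclidDist y x / r) 0
    let bt : ℝ → ℝ := fun a => r⁻¹ * max (1 - |a| / r) 0
    let ρm : Config (N + 1) (Fin 3) T3 → T3 → ℝ := fun w x => ∫ q, bx q.1 x ∂(empiricalMeasure w)
    let φδ : V3 → ℝ := fun v => localMaxwellian 1 (δ ^ 2) 0 v
    let y₀ : V3 → ℝ := fun v => Real.exp (-K) * ((1 + ‖v‖ ^ 2) ^ 2)⁻¹
    let ℓK : V3 → ℝ → ℝ := fun v y => if y₀ v ≤ y then Real.log y else Real.log (y₀ v) + (y - y₀ v) / y₀ v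
    let g : Config (N + 1) (Fin 3) T3 → T3 → V3 → ℝ := fun w x v =>
      ∫ q, bx q.1 x * φδ (v - q.2) ∂(empiricalMeasure w)
    let Λt : Config (N + 1) (Fin 3) T3 → T3 → V3 → ℝ := fun w x v => ∫ u, φδ (v - u) * ℓK u (g w x u)
    let pv : ℝ → Fin (N + 1) → Fin (N + 1) → V3 × V3 := fun s i j =>
      reflectVel (Gm.sepVec (γ s i).1 (γ s j).1) ((γ s i).2, (γ s j).2)
    let Kent : ℝ := ε / (N + 1 : ℝ) * ∑ᶠ (s : ℝ) (_ : s ∈ collisionTimes Gm ε γ ∩ Set.Icc 0 τ),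
        ∑ i : Fin (N + 1), ∑ j : Fin (N + 1),
          (if i ≠ j ∧ ‖Gm.sepVec (γ s i).1 (γ s j).1‖ = ε then
            bt (s - t₀) * ∫ x, bx x x₀ * h (ρm (γ s) x) * bx (γ s i).1 x *
              (Λt (γ s) x (pv s i j).1 - Λt (γ s) x (γ s i).2) else 0)
    let Q4 : ℝ := ε / (N + 1 : ℝ) * ∑ᶠ (s : ℝ) (_ : s ∈ collisionTimes Gm ε γ ∩ Set.Icc 0 τ),
        ∑ i : Fin (N + 1), ∑ j : Fin (N + 1),
          (if i ≠ j ∧ ‖Gm.sepVec (γ s i).1 (γ s j).1‖ = ε then 1 + ‖(γ s i).2‖ ^ 4 + ‖(γ s j).2‖ ^ 4 else 0)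
    |Kent| ≤ ε * C₁ * (1 + configEnergy z / (N + 1 : ℝ)) ^ 3 + C₂ * Q4 / (N + 1 : ℝ)

/-- **Pointwise entropic chaos (PEnC; NEW INPUT of this line — same-time molecular chaos for the entropic mark, in
the format of `PointwiseEnskogCollisions`).**  `∃ η₀`: for `σ < σ₀(profiles)`, local Gibbs data, every horizon `τ`,
every velocity coarse-graining `δ > 0` and every bounded continuous density weight `h(ρ)` vanishing out of band
(`σ³ρ ≥ η₀`), every tolerance `η` — all FIXED before `r` — every log-floor depth `K ≥ K₀(η, …)` and every pair-energy cut
`L ≥ L₀` (`|v⁻|² + |v⁻_*|² ≤ L` on both sides; the set is collision-invariant, so positivity survives and the smoothed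
law's `|v|⁻⁴` floor tail does not make the prediction diverge), the tent ×
cone windowed, normalised collision functional of the entropic mark (the functional `Kent` of
`WindowedEntropyBalance`) at window `(t₀, x₀)` equals `σ³` times the same window of `h(ρ_r) · Y(σ³ρ_r) · 𝒫`, where
`𝒫(s, x) = ∫∫ Θ_x(v, u) G̃_x(v) G̃_x(u) dv du` is the Enskog prediction computed on the SMOOTHED cone law
`G̃_x = exp Λ̃_x` (`Θ_x(v,u) = ∫ [Λ̃_x(v) − Λ̃_x(v′)]((u − v)·ω)₊ dω`, `v′ = (collide ω (v,u)).1`; `Y = (3/2π) f_ex′`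
the contact value, `HsEosLowDensity`, proved), up to an error `≤ η` in `L¹(dt₀ dx₀)` over `[0, τ] × 𝕋³` with
probability `≥ 1 − δ′` (`N ≥ N₀`, `r < r₀`).  Conventions (ordered contact pairs, pre-collisional marks `pv`, kernel
`hardSphereKernel (u, v)`) VERBATIM those of PEC / 13477 / 13481; the mark grows like `log(1+|v|²)` (PCC's class).
WHY THIS TYPING.  For a FIXED bounded continuous mark the statement is PEC up to `g ⊗ g` versus `μ̂ ⊗ μ̂` on the
prediction side (equivalent as `δ → 0` on tight sets).  The entropic mark is law-dependent, and the geometric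
mollification `G̃ = exp(φ_δ ∗ ℓ_K(g))` is used on the prediction side so that the prediction is EXACTLY twice the
entropy production of `G̃` (`≥ 0`, Boltzmann's inequality; `Literature.Analysis.FluidPDE.entropyProduction_nonneg`)
— the one modelling choice of the line: chaos is asserted w.r.t. the cone law as seen at velocity resolution `δ`.
`K` comes AFTER `η` because the floored log makes the prediction of an exactly Maxwellian window not `0` but
`O(K^a e^{−K})` (collisions with the floor tail), while the particle side tends to `0` by WEB.  A disprover aims at
transient velocity fine structure below `δ` (cold beams inside a warm gas); the smooth balance-compensating
oscillation of the lead's §F1 witness is NOT a counterexample — it violates PEnC ∧ WEB, as it must, since chaotic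
collisions w.r.t. a smooth non-Maxwellian law raise the coarse entropy at rate `D/ε`. -/
def PointwiseEntropicChaos : Prop :=
  ∃ η₀ : ℝ, 0 < η₀ ∧ ∀ (a₀ θ₀ : T3 → ℝ) (u₀ : T3 → V3), Continuous a₀ → Continuous θ₀ → Continuous u₀ →
    (∀ x, 0 < a₀ x) → (∀ x, 0 < θ₀ x) → ∃ σ₀ : ℝ, 0 < σ₀ ∧ ∀ σ : ℝ, 0 < σ → σ < σ₀ →
    ∀ Φ : (N : ℕ) → HardSphereFlow (Torus.geometry (Fin 3)) (hsDiameter σ N) (N + 1),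
    ∀ τ : ℝ, 0 < τ → ∀ δ : ℝ, 0 < δ →
    ∀ h : ℝ → ℝ, Continuous h → (∃ C : ℝ, ∀ a, |h a| ≤ C) → (∀ a : ℝ, η₀ ≤ σ ^ 3 * a → h a = 0) →
    ∀ η δ' : ℝ, 0 < η → 0 < δ' → ∃ K₀ : ℝ, ∀ K : ℝ, K₀ ≤ K → ∃ L₀ : ℝ, ∀ L : ℝ, L₀ ≤ L →
    ∃ r₀ : ℝ, 0 < r₀ ∧ ∀ r : ℝ, 0 < r → r < r₀ → ∃ N₀ : ℕ, ∀ N : ℕ, N₀ ≤ N →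
    let ε := hsDiameter σ N
    let Gm : Geometry (Fin 3) T3 := Torus.geometry (Fin 3)
    let γ : Config (N + 1) (Fin 3) T3 → ℝ → Config (N + 1) (Fin 3) T3 := fun z s => (Φ N).flow s z
    let bx : T3 → T3 → ℝ := fun y x => 3 / (Real.pi * r ^ 3) * max (1 - Torus.euclidDist y x / r) 0
    let bt : ℝ → ℝ := fun a => r⁻¹ * max (1 - |a| / r) 0
    let ρm : Config (N + 1) (Fin 3) T3 → T3 → ℝ := fun w x => ∫ q, bx q.1 x ∂(empiricalMeasure w)
    let φδ : V3 → ℝ := fun v => localMaxwellian 1 (δ ^ 2) 0 v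
    let y₀ : V3 → ℝ := fun v => Real.exp (-K) * ((1 + ‖v‖ ^ 2) ^ 2)⁻¹
    let ℓK : V3 → ℝ → ℝ := fun v y => if y₀ v ≤ y then Real.log y else Real.log (y₀ v) + (y - y₀ v) / y₀ v
    let g : Config (N + 1) (Fin 3) T3 → T3 → V3 → ℝ := fun w x v =>
      ∫ q, bx q.1 x * φδ (v - q.2) ∂(empiricalMeasure w)
    let Λt : Config (N + 1) (Fin 3) T3 → T3 → V3 → ℝ := fun w x v => ∫ u, φδ (v - u) * ℓK u (g w x u)
    let Gt : Config (N + 1) (Fin 3) T3 → T3 → V3 → ℝ := fun w x v => Real.exp (Λt w x v)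
    let Θ : Config (N + 1) (Fin 3) T3 → T3 → V3 → V3 → ℝ := fun w x v u =>
      ∫ ω : Metric.sphere (0 : V3) 1,
        (Λt w x v - Λt w x (collide ω (v, u)).1) * hardSphereKernel (u, v) ω ∂sphereMeasure
    let cut : V3 → V3 → ℝ := fun v u => if ‖v‖ ^ 2 + ‖u‖ ^ 2 ≤ L then 1 else 0
    let Pred : Config (N + 1) (Fin 3) T3 → T3 → ℝ := fun w x =>
      ∫ v, ∫ u, cut v u * Θ w x v u * (Gt w x v * Gt w x u)
    let pv : Config (N + 1) (Fin 3) T3 → ℝ → Fin (N + 1) → Fin (N + 1) → V3 × V3 := fun z s i j =>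
      reflectVel (Gm.sepVec (γ z s i).1 (γ z s j).1) ((γ z s i).2, (γ z s j).2)
    let Y : ℝ → ℝ := fun a => 3 / (2 * Real.pi) * deriv hsExcessFreeEnergy a
    let Kr : Config (N + 1) (Fin 3) T3 → ℝ → T3 → ℝ := fun z t₀ x₀ =>
      ε / (N + 1 : ℝ) * ∑ᶠ (s : ℝ) (_ : s ∈ collisionTimes Gm ε (γ z) ∩ Set.Icc 0 τ),
        ∑ i : Fin (N + 1), ∑ j : Fin (N + 1),
          (if i ≠ j ∧ ‖Gm.sepVec (γ z s i).1 (γ z s j).1‖ = ε then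
            bt (s - t₀) * cut (pv z s i j).1 (pv z s i j).2 *
              ∫ x, bx x x₀ * h (ρm (γ z s) x) * bx (γ z s i).1 x *
                (Λt (γ z s) x (pv z s i j).1 - Λt (γ z s) x (γ z s i).2) else 0)
    let R : Config (N + 1) (Fin 3) T3 → ℝ → T3 → ℝ := fun z t₀ x₀ =>
      σ ^ 3 * ∫ s in Set.Icc 0 τ, bt (s - t₀) *
        ∫ x, bx x x₀ * (h (ρm (γ z s) x) * Y (σ ^ 3 * ρm (γ z s) x) * Pred (γ z s) x)
    localGibbsLaw σ a₀ u₀ θ₀ N (Φ N)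
      {z | η < ∫ t₀ in Set.Icc 0 τ, ∫ x₀, |Kr z t₀ x₀ - R z t₀ x₀|} ≤ ENNReal.ofReal δ'

/-- **Dissipation rigidity (own, L, provable now): small entropy production of the smoothed law forces the
`ψ`-moments of a finite measure to be those of the Maxwellian of its own fields**, uniformly on the class
{mass `∈ [ρ₁, ρ₂]`, `|v|²` uniformly integrable with modulus `Lt`, temperature `≥ θ₁`}, at EVERY coarse-graining
`δ > 0`.  For every bounded continuous `ψ` and `ε > 0` there are a threshold `η > 0` and a floor depth `K₁` such that
for every `K ≥ K₁` there is a pair-energy cut `L₁` such that for every `L ≥ L₁` there is a depth `n` of the UI modulus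
such that every such `m` whose smoothed-law dissipation
`D_{K,L}(m) = ∫∫_{|v|²+|u|²≤L}∫ [Λ̃(v)+Λ̃(u)−Λ̃(v′)−Λ̃(u′)] ((u−v)·ω)₊ dω G̃(v)G̃(u) dv du ≤ η` (twice the entropy production
of `G̃` restricted to a collision-invariant set, `≥ 0` termwise; the
`g, ℓ_K, Λ̃, G̃` of `PointwiseEntropicChaos` with the cone law replaced by `m`) satisfies
`|∫ψ dm − ρ_m ∫ψ M_{1,θ_m,u_m}| ≤ ε`.  Proof (compactness + Boltzmann + Gauss): if not, first let `n → ∞` at fixed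
`K` (weak limits keep `D_K ≤ η` and the failure: everything is weakly continuous under UI at fixed `δ, K`), then
`η_k → 0, K_k, L_k → ∞`: `m_k ⇀ m` in the class, `Λ̃_k → Λ̃_∞ = φ_δ ∗ log(m ∗ φ_δ)` locally uniformly (the floor
`y₀ → 0` pointwise; quadratic domination from the mass lower bound and the energy bound), Fatou on the nonnegative
integrand `(a−b)log(a/b)·B` ⇒ `entropyProduction(G̃_∞) = 0` ⇒ `Λ̃_∞` is a continuous collision invariant
(`B > 0` off a null cone, continuity) ⇒ quadratic (`IsCollisionInvariant.exists_eq_quadratic_holds`, in tree) ⇒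
`log(m ∗ φ_δ)` quadratic (Gaussian convolution is injective on tempered functions and maps quadratics onto quadratics)
⇒ `m ∗ φ_δ` is an isotropic Gaussian ⇒ `m = ρ_m M_{1,θ_m,u_m}` (divide characteristic functions by
`e^{−δ²|ξ|²/2}`, `Measure.ext_of_charFun`; `θ_m ≥ θ₁ > 0` by UI) — contradicting the failure. [CIP1994 §3.1–3.2;
folklore] -/
def DissipationRigidity : Prop :=
  ∀ (Lt : ℕ → ℝ) (ρ₁ ρ₂ θ₁ : ℝ), 0 < ρ₁ → 0 < θ₁ →
    ∀ ψ : V3 → ℝ, Continuous ψ → (∃ C : ℝ, ∀ v, |ψ v| ≤ C) → ∀ δ : ℝ, 0 < δ → ∀ ε : ℝ, 0 < ε →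
    ∃ η : ℝ, 0 < η ∧ ∃ K₁ : ℝ, ∀ K : ℝ, K₁ ≤ K → ∃ L₁ : ℝ, ∀ L : ℝ, L₁ ≤ L → ∃ n : ℕ,
    ∀ m : Measure V3, IsFiniteMeasure m → Integrable (fun v : V3 => ‖v‖ ^ 2) m →
      ρ₁ ≤ (m Set.univ).toReal → (m Set.univ).toReal ≤ ρ₂ →
      (∀ j : ℕ, j ≤ n → ∫ v in {v : V3 | Lt j < ‖v‖}, ‖v‖ ^ 2 ∂m ≤ 1 / ((j : ℝ) + 1)) →
    let φδ : V3 → ℝ := fun v => localMaxwellian 1 (δ ^ 2) 0 v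
    let y₀ : V3 → ℝ := fun v => Real.exp (-K) * ((1 + ‖v‖ ^ 2) ^ 2)⁻¹
    let ℓK : V3 → ℝ → ℝ := fun v y => if y₀ v ≤ y then Real.log y else Real.log (y₀ v) + (y - y₀ v) / y₀ v
    let g : V3 → ℝ := fun v => ∫ w, φδ (v - w) ∂m
    let Λt : V3 → ℝ := fun v => ∫ u, φδ (v - u) * ℓK u (g u)
    let Gt : V3 → ℝ := fun v => Real.exp (Λt v)
    let cut : V3 → V3 → ℝ := fun v u => if ‖v‖ ^ 2 + ‖u‖ ^ 2 ≤ L then 1 else 0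
    let D : ℝ := ∫ v, ∫ u, cut v u * (∫ ω : Metric.sphere (0 : V3) 1,
        (Λt v + Λt u - Λt (collide ω (v, u)).1 - Λt (collide ω (v, u)).2) * hardSphereKernel (u, v) ω
          ∂sphereMeasure) * (Gt v * Gt u)
    let ρm : ℝ := (m Set.univ).toReal
    let um : V3 := ρm⁻¹ • ∫ v, v ∂m
    let θm : ℝ := 2 / 3 * ((∫ v, ‖v‖ ^ 2 / 2 ∂m) / ρm - ‖∫ v, v ∂m‖ ^ 2 / (2 * ρm ^ 2))
    θ₁ ≤ θm → D ≤ η → |(∫ v, ψ v ∂m) - ρm * ∫ v, ψ v * localMaxwellian 1 θm um v| ≤ ε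

/-! ## §2 The registered stubs -/

/-- STUB `stub_boardInputs` (EXTERNAL — not work of this line): the dock's other inputs, by name or verbatim:
`PointwiseEnskogCollisions` (the dock's `hPEC`; strategist-s1 child, to be filed), the clamped second law
`LimitCollisionMeasure.LocalSecondLaw` (stmt-13352), quartic collision tightness
`LimitCollisionMeasure.CollisionTightness` (stmt-13354; also pays WEB's second-order remainder), cubic one-body tails
`TwoClocks.EnergyCurrentTails` (stmt-9235; also the UI of cone-law energies in the assembly) and the route's own
`DensityCap` (stmt-13082).  A seat handed this stub answers `stub-blocked` naming the items. -/
theorem stub_boardInputs :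
    PointwiseEnskogCollisions ∧ LimitCollisionMeasure.LocalSecondLaw ∧ LimitCollisionMeasure.CollisionTightness ∧
      TwoClocks.EnergyCurrentTails ∧ DensityCap := by
  sorry

/-- STUB `stub_entropicChaos` (NEW INPUT, Boltzmann-hypothesis class; the ONE kinetic input of the line beyond the
dock's PEC): body VERBATIM `PointwiseEntropicChaos`. -/
theorem stub_entropicChaos : PointwiseEntropicChaos := by
  sorry

/-- STUB `stub_windowedEntropyBalance` (CLOSED — landed p166416 + helpers A–G, wave 11, `Theorems.ChaosClosesEulerEntropyBalance`): body VERBATIM `WindowedEntropyBalance`. -/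
theorem stub_windowedEntropyBalance : WindowedEntropyBalance :=
  Summit.AtomisticToContinuum.HydrodynamicLimit.Theorems.ChaosClosesEulerEntropyBalance.stub_windowedEntropyBalance

/-- STUB `stub_dissipationRigidity` (CLOSED — landed p164687 + helpers A–G, wave 11, `Theorems.ChaosClosesEulerDissipationRigidity`): body VERBATIM `DissipationRigidity`. -/
theorem stub_dissipationRigidity : DissipationRigidity :=
  Summit.AtomisticToContinuum.HydrodynamicLimit.Theorems.ChaosClosesEulerDissipationRigidity.stub_dissipationRigidity

/-- STUB `stub_localEquilibriumFromDissipation` (CLOSED — landed p169406 + helpers A–I, wave 11, `Theorems.ChaosClosesEulerLocalEquilibriumFromDissipation`; was the hardest OWN stub): **pointwise local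
equilibrium from the empirical H-theorem.**  Given PLE's data (`ψ`, state weight `h` with cut-offs
`ρ₁, θ₁, Θ, U`, band `η₀`, tolerances): (1) `DissipationRigidity` for the class (mass `∈ [ρ₁, η₀/σ³]`, UI modulus
from the cubic tails 9235, `θ ≥ θ₁`; any `δ`, say `δ = 1`) yields `η_rig` and `K₁`; `PointwiseEntropicChaos` with tolerance `η′ ≪ η_rig·η` yields `K₀`; fix `K = max K₀ K₁`, then
`L = max L₀ L₁ L_UI` and the UI depth `n`; (2) `WindowedEntropyBalance` with a Lipschitz
density weight `h_ρ ∈ [0,1]` (`= 1` where PLE's `h` can be nonzero, `= 0` near vacuum and out of band) bounds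
`∫|Kent| dt₀dx₀` by `ε_N C₁(1+E/(N+1))³ + C₂ Q⁴/(N+1)` pathwise, `→ 0` in probability by 13354 and the LLN for
`E/(N+1)`; (3) split `Kent = Kent_{≤L} + Kent_{>L}` by the pair-energy cut; `Kent_{>L}` is bounded by the UI tail of the quadratic
collision mark (`ChaosClosesEulerCollisionMomentUI.stub_collisionMomentUI`, landed, from 13354; the mark has log growth);
`PointwiseEntropicChaos` with the same `(δ, K, L, h_ρ)` transfers the bound on `Kent_{≤L}` to `∫∫ |R| ≤ η′` w.h.p.;
`R ≥ 0` pointwise (`Pred = ` the entropy production of `G̃` restricted to the collision-invariant set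
`{|v|²+|u|² ≤ L}`, `≥ 0` termwise by the symmetrisation `(v,u,ω) ↦ (u,v,−ω)` and Boltzmann's inequality;
`h_ρ, Y ≥ 0`; `∫ bt(s−t₀)dt₀ ≥ 1/2`) so `σ³ ∫₀ᵗ∫ₓ h_ρ Y · Pred ≤ 2η′`: the `h_ρ`-weighted volume of
windows `(s,x)` with `D(G̃_{s,x}) > η_rig` is `≤ Cη′/η_rig`; (4) UI of `|v|²` for the cone laws holds outside a
set of windows of small volume w.h.p. (9235 at each `s ≤ t`, Markov, Fubini); (5) on the remaining windows with
`θ_r ≥ θ₁` rigidity gives `|M_ψ − ρ_r ∫ψ M_{1,θ_r,u_r}| ≤ ε`, the excluded windows cost `≤ 2‖ψ‖‖h‖(η₀/σ³)·volume`;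
choose `η′`, then `r₀`, `N₀`.  Tools: `ChaosClosesEulerMaxwellianMoments.stub_maxwellianMoments` (landed),
measurability of the cone functionals (landed Shell*/Readout* helpers). -/
theorem stub_localEquilibriumFromDissipation :
    WindowedEntropyBalance → PointwiseEntropicChaos → DissipationRigidity →
    TwoClocks.EnergyCurrentTails → LimitCollisionMeasure.CollisionTightness →
    PointwiseLocalEquilibrium :=
  Summit.AtomisticToContinuum.HydrodynamicLimit.Theorems.ChaosClosesEulerLocalEquilibriumFromDissipation.stub_localEquilibriumFromDissipation

/-! ## §3 The composition (pure logic, no `sorry`) -/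

/-- **The crux from the five stubs of line `EmpiricalHTheorem`** (kernel-checked composition): the assembly
`stub_localEquilibriumFromDissipation` fed with WEB, PEnC, dissipation rigidity, 9235 and 13354 yields PLE, and the
LANDED dock `ChaosClosesEulerDock.stub_dock` (p157936) takes PLE, PEC, 13352, 13354, 9235, 13082 to the crux. -/
theorem ChaosClosesEuler_of : ChaosClosesEuler := by
  obtain ⟨hPEC, hLSL, hCT, hECT, hDC⟩ := stub_boardInputs
  exact Summit.AtomisticToContinuum.HydrodynamicLimit.Theorems.ChaosClosesEulerDock.stub_dock
    (stub_localEquilibriumFromDissipation stub_windowedEntropyBalance stub_entropicChaos stub_dissipationRigidity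
      hECT hCT) hPEC hLSL hCT hECT hDC

end Summit.AtomisticToContinuum.HydrodynamicLimit.Cruxes.ChaosClosesEuler.EmpiricalHTheorem

end
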